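import Summits.HubbardSuperconductivity.HubbardSuperconductivity.Theorems.AnisotropyChordSpinMonotoneTwoMagnonRookWeightedAll
import Summits.HubbardSuperconductivity.HubbardSuperconductivity.Theorems.AnisotropyChordSpinMonotoneTwoMagnonRookWeightedEigen
import Summits.HubbardSuperconductivity.HubbardSuperconductivity.Theorems.AnisotropyChordSpinMonotoneTwoMagnonRookWeightedClasses
import Summits.HubbardSuperconductivity.HubbardSuperconductivity.Theorems.AnisotropyChordXXZWeightedInvariant
import Summits.HubbardSuperconductivity.HubbardSuperconductivity.Theorems.AnisotropyChordSpinMonotoneTwoMagnonCondensateTransitive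
import Summits.HubbardSuperconductivity.HubbardSuperconductivity.Theorems.AnisotropyChordSpinMonotoneTwoMagnonRook

/-!
# Route `AnisotropyChord`: **THEOREM R in the tree** — two-magnon condensate monotonicity on the
# rook graph `K_m □ K_n` with ARBITRARY direction weights `J₁, J₂ > 0`

**Theorem** (`wrook_twoMagnon_condensate_monotone`).  Let `G` be the rook graph on `α × β`
(`|α|, |β| ≥ 2`) and `H(Δ) = xxzHamiltonianWith 1 G J Δ` the ferromagnetic bond-weighted XXZ
Hamiltonian with direction couplings `J = −J₁` on row bonds (`x.2 = y.2`) and `J = −J₂` on column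
bonds (`J₁, J₂ > 0` arbitrary).  In the two-magnon sector `S^z_tot = |V|/2 − 2`, for all
`Δ₁ ≤ Δ₂ < 1` and normalised sector ground states `ψ₁, ψ₂`:
`Λ(ψ₁) ≤ Λ(ψ₂)`, `Λ(ψ) = Re⟨ψ, S⁺_tot S⁻_tot ψ⟩`.  This is THEOREM R of the theory seat
`hubbard-h0-rotor-theory-1` (ROTOR-THEORY-5 §41) — the first two-magnon monotonicity theorem with
TWO contact orbits and arbitrary anisotropy of the couplings, including the discordant regime.

Assembly: Perron–Frobenius for `xxzHamiltonianWith` (`Weighted.xxzWith_sector_perronFrobenius`) and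
invariance under the weight-preserving automorphisms `prodCongr e₁ e₂`
(`Weighted.xxzWith_sectorGS_comp_eq_self`) make the ground state a positive multiple of a real
nonnegative class-constant vector (`wrook_positive_classes`); the three class equations
(`wrook_eigen_relations`) give a physical point of the normalised quotient (`wrook_point_of_classes`,
`wrook_classes_pos`); the condensate is an increasing affine function of the flat overlap
(`condensate_eq_flatOverlap_of_transitive_invariance`, `rook_flat_norm`), which equals
`(N/2)(p+q+pq)·W(u,v)` (`wrook_flatOverlap_eq`); and `W` is antitone in `σ = 1 − Δ` along physical
points for EVERY coupling ratio (`wrook_flatOverlap_antitone_all`: criterion certificates + analytic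
branch + orbit swap + the `J₁ = J₂` profile).  H. Tasaki (2020) §2.4, App. A.  No definition is
introduced.  (`Δ₂ = 1` — flat ground state, `σ = 0` — is the trivial maximum and is not covered by
the strict hypothesis `Δ₂ < 1` here.)
-/

set_option linter.dupNamespace false

noncomputable section

namespace Summit.HubbardSuperconductivity.HubbardSuperconductivity.Theorems.AnisotropyChord.TwoMagnon

open Matrix Complex Finset
open Literature.MathematicalPhysics.QuantumLattice
open Summit.HubbardSuperconductivity.HubbardSuperconductivity.Theorems.AnisotropyChord.Weighted
  (xxzWith_sector_perronFrobenius xxzWith_sectorGS_comp_eq_self)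

variable {α β : Type*} [Fintype α] [DecidableEq α] [Fintype β] [DecidableEq β]

/-! ### Class-constancy from invariance under coordinate permutations only -/

section Classes

variable {f : (α × β → Fin 2) → ℂ}

omit [Fintype α] [Fintype β] in
/-- A vector fixed by the coordinate permutations `prodCongr e₁ e₂` takes the same value on a pair
and on its image. [folklore] -/
theorem apply_pair_eq_of_prodCongr
    (hfix : ∀ (e₁ : α ≃ α) (e₂ : β ≃ β) (σ : α × β → Fin 2), f (σ ∘ Equiv.prodCongr e₁ e₂) = f σ)
    (e₁ : α ≃ α) (e₂ : β ≃ β) (i j : α × β) :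
    f (Pi.single i 1 + Pi.single j 1) =
      f (Pi.single (Equiv.prodCongr e₁ e₂ i) 1 + Pi.single (Equiv.prodCongr e₁ e₂ j) 1) := by
  have h := hfix e₁ e₂ (Pi.single (Equiv.prodCongr e₁ e₂ i) 1 + Pi.single (Equiv.prodCongr e₁ e₂ j) 1)
  rw [pair_comp_equiv, Equiv.symm_apply_apply, Equiv.symm_apply_apply] at h
  exact h

omit [Fintype α] [Fintype β] in
/-- **Row pairs form one class** under coordinate-permutation invariance. [folklore] -/
theorem wrowPair_eq
    (hfix : ∀ (e₁ : α ≃ α) (e₂ : β ≃ β) (σ : α × β → Fin 2), f (σ ∘ Equiv.prodCongr e₁ e₂) = f σ)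
    {i j i' j' : α × β} (h1 : i.1 ≠ j.1) (h2 : i.2 = j.2) (h1' : i'.1 ≠ j'.1) (h2' : i'.2 = j'.2) :
    f (Pi.single i 1 + Pi.single j 1) = f (Pi.single i' 1 + Pi.single j' 1) := by
  obtain ⟨e₁, ha, hb⟩ := exists_perm_apply_pair h1 h1'
  have hπi : Equiv.prodCongr e₁ (Equiv.swap i.2 i'.2) i = i' := by
    rw [prodCongr_apply_mk, ha, Equiv.swap_apply_left]
  have hπj : Equiv.prodCongr e₁ (Equiv.swap i.2 i'.2) j = j' := by
    rw [prodCongr_apply_mk, hb, ← h2, Equiv.swap_apply_left, h2']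
  rw [apply_pair_eq_of_prodCongr hfix e₁ (Equiv.swap i.2 i'.2) i j, hπi, hπj]

omit [Fintype α] [Fintype β] in
/-- **Column pairs form one class** under coordinate-permutation invariance. [folklore] -/
theorem wcolPair_eq
    (hfix : ∀ (e₁ : α ≃ α) (e₂ : β ≃ β) (σ : α × β → Fin 2), f (σ ∘ Equiv.prodCongr e₁ e₂) = f σ)
    {i j i' j' : α × β} (h1 : i.1 = j.1) (h2 : i.2 ≠ j.2) (h1' : i'.1 = j'.1) (h2' : i'.2 ≠ j'.2) :
    f (Pi.single i 1 + Pi.single j 1) = f (Pi.single i' 1 + Pi.single j' 1) := by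
  obtain ⟨e₂, ha, hb⟩ := exists_perm_apply_pair h2 h2'
  have hπi : Equiv.prodCongr (Equiv.swap i.1 i'.1) e₂ i = i' := by
    rw [prodCongr_apply_mk, ha, Equiv.swap_apply_left]
  have hπj : Equiv.prodCongr (Equiv.swap i.1 i'.1) e₂ j = j' := by
    rw [prodCongr_apply_mk, hb, ← h1, Equiv.swap_apply_left, h1']
  rw [apply_pair_eq_of_prodCongr hfix (Equiv.swap i.1 i'.1) e₂ i j, hπi, hπj]

omit [Fintype α] [Fintype β] in
/-- **Far pairs form one class** under coordinate-permutation invariance. [folklore] -/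
theorem wfarPair_eq
    (hfix : ∀ (e₁ : α ≃ α) (e₂ : β ≃ β) (σ : α × β → Fin 2), f (σ ∘ Equiv.prodCongr e₁ e₂) = f σ)
    {i j i' j' : α × β} (h1 : i.1 ≠ j.1) (h2 : i.2 ≠ j.2) (h1' : i'.1 ≠ j'.1) (h2' : i'.2 ≠ j'.2) :
    f (Pi.single i 1 + Pi.single j 1) = f (Pi.single i' 1 + Pi.single j' 1) := by
  obtain ⟨e₁, ha, hb⟩ := exists_perm_apply_pair h1 h1'
  obtain ⟨e₂, hc, hd⟩ := exists_perm_apply_pair h2 h2'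
  have hπi : Equiv.prodCongr e₁ e₂ i = i' := by rw [prodCongr_apply_mk, ha, hc]
  have hπj : Equiv.prodCongr e₁ e₂ j = j' := by rw [prodCongr_apply_mk, hb, hd]
  rw [apply_pair_eq_of_prodCongr hfix e₁ e₂ i j, hπi, hπj]

end Classes

/-! ### The direction weight -/

omit [Fintype α] [DecidableEq α] [Fintype β] in
/-- The direction weight `J(x,y) = −J₁` if `x.2 = y.2`, `−J₂` otherwise, is preserved by coordinate
permutations. [folklore] -/
theorem dirWeight_map_prodCongr {J : Sym2 (α × β) → ℝ} {J₁ J₂ : ℝ}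
    (hJ : ∀ x y : α × β, J s(x, y) = if x.2 = y.2 then -J₁ else -J₂) (e₁ : α ≃ α) (e₂ : β ≃ β)
    (e : Sym2 (α × β)) : J (Sym2.map (Equiv.prodCongr e₁ e₂) e) = J e := by
  induction e using Sym2.ind with
  | h x y =>
    rw [Sym2.map_mk, hJ, hJ]
    simp only [Equiv.prodCongr_apply, Prod.map_snd, e₂.apply_eq_iff_eq]

omit [Fintype α] [DecidableEq α] [Fintype β] in
/-- The direction weight is negative everywhere (`J₁, J₂ > 0`), in particular on every bond.
[folklore] -/
theorem dirWeight_neg {J : Sym2 (α × β) → ℝ} {J₁ J₂ : ℝ} (hJ₁ : 0 < J₁) (hJ₂ : 0 < J₂)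
    (hJ : ∀ x y : α × β, J s(x, y) = if x.2 = y.2 then -J₁ else -J₂) (e : Sym2 (α × β)) :
    J e < 0 := by
  induction e using Sym2.ind with
  | h x y => rw [hJ]; split_ifs <;> linarith

/-! ### The physical point of a sector ground state and its flat overlap -/

/-- **A normalised two-magnon sector ground state of the weighted rook Hamiltonian determines a
physical point** `(u, v)` of the normalised quotient (coupling ratio `J₂/J₁`, coupling `1 − Δ`) with
`u, v > 0`, and its flat overlap is `‖⟨φ,ψ⟩‖² = (N/2)·(pu + qv + pq)²/(pu² + qv² + pq)`
(`p = |α|−1`, `q = |β|−1`, `N = |α||β|`).  Perron–Frobenius, class reduction, the three class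
equations and the flat-overlap/norm formulas of a class-constant vector. [folklore] -/
theorem wrook_flatOverlap_eq (G : SimpleGraph (α × β)) [DecidableRel G.Adj]
    (hadj : ∀ x y : α × β, G.Adj x y ↔ (x.1 ≠ y.1 ∧ x.2 = y.2) ∨ (x.1 = y.1 ∧ x.2 ≠ y.2))
    {a₀ a₁ : α} (hα : a₀ ≠ a₁) {b₀ b₁ : β} (hβ : b₀ ≠ b₁)
    (J : Sym2 (α × β) → ℝ) {J₁ J₂ : ℝ} (hJ₁ : 0 < J₁) (hJ₂ : 0 < J₂)
    (hJ : ∀ x y : α × β, J s(x, y) = if x.2 = y.2 then -J₁ else -J₂)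
    {φ : (α × β → Fin 2) → ℂ} (hφ : ∀ σ, φ σ = if (∑ z, (σ z : ℕ)) = 2 then 1 else 0)
    {Δ : ℝ} {ψ : (α × β → Fin 2) → ℂ}
    (gm : ψ ∈ spinZSector (Λ := α × β) 1 ((Fintype.card (α × β) : ℝ) / 2 - 2))
    (gn : star ψ ⬝ᵥ ψ = 1)
    (ge : xxzHamiltonianWith 1 G J Δ *ᵥ ψ =
      ((lowestEnergyInSector 1 (xxzHamiltonianWith 1 G J Δ) ((Fintype.card (α × β) : ℝ) / 2 - 2) : ℝ) : ℂ) • ψ)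
    (p q : ℝ) (hp : p = (Fintype.card α : ℝ) - 1) (hq : q = (Fintype.card β : ℝ) - 1) :
    ∃ u v E' : ℝ, 0 < u ∧ 0 < v ∧
      u * ((J₂ / J₁) * q + (1 - Δ) - E') = (J₂ / J₁) * q ∧
      v * (p + (1 - Δ) * (J₂ / J₁) - E') = p ∧
      E' = (1 - v) + (J₂ / J₁) * (1 - u) ∧
      ‖star φ ⬝ᵥ ψ‖ ^ 2 = (Fintype.card (α × β) : ℝ) / 2 *
        ((p * u + q * v + p * q) ^ 2 / (p * u ^ 2 + q * v ^ 2 + p * q)) := by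
  haveI : Nonempty α := ⟨a₀⟩
  haveI : Nonempty β := ⟨b₀⟩
  have hcardα : (1 : ℝ) < Fintype.card α := by
    exact_mod_cast Fintype.one_lt_card_iff_nontrivial.mpr ⟨⟨a₀, a₁, hα⟩⟩
  have hcardβ : (1 : ℝ) < Fintype.card β := by
    exact_mod_cast Fintype.one_lt_card_iff_nontrivial.mpr ⟨⟨b₀, b₁, hβ⟩⟩
  have hp0 : 0 < p := by rw [hp]; linarith
  have hq0 : 0 < q := by rw [hq]; linarith
  have hG : G.Connected := rook_connected hadj
  have hJneg : ∀ e ∈ G.edgeFinset, J e < 0 := fun e _ => dirWeight_neg hJ₁ hJ₂ hJ e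
  have hw₁ : ∀ x y : α × β, x.1 ≠ y.1 → x.2 = y.2 → J s(x, y) = -J₁ := fun x y _ h2 => by
    rw [hJ, if_pos h2]
  have hw₂ : ∀ x y : α × β, x.1 = y.1 → x.2 ≠ y.2 → J s(x, y) = -J₂ := fun x y _ h2 => by
    rw [hJ, if_neg h2]
  have hrow : ((a₀, b₀) : α × β) ≠ (a₁, b₀) := fun h => hα (congrArg Prod.fst h)
  -- Perron–Frobenius: a nonnegative real sector ground vector `χ`, and `ψ = c • χ`
  have hW : ∃ σ : TensorIndex (α × β) 2, (∑ z, (σ z : ℕ)) = 2 := ⟨_, weight_pair hrow⟩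
  obtain ⟨⟨χ, hχK, hχ0, hχnn, hχH⟩, huniq⟩ := xxzWith_sector_perronFrobenius 1 G hG J hJneg Δ 2 hW
  have hM : ((Fintype.card (α × β) * 1 : ℕ) : ℝ) / 2 - ((2 : ℕ) : ℝ) =
      (Fintype.card (α × β) : ℝ) / 2 - 2 := by push_cast; ring
  rw [hM] at hχK hχH huniq
  obtain ⟨c, hc⟩ := huniq χ ψ hχK gm hχH ge hχ0
  -- invariance of `χ` under coordinate permutations, class values
  have hfixχ : ∀ (e₁ : α ≃ α) (e₂ : β ≃ β) (σ : α × β → Fin 2),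
      χ (σ ∘ Equiv.prodCongr e₁ e₂) = χ σ :=
    fun e₁ e₂ σ => congrFun (xxzWith_sectorGS_comp_eq_self G hG J hJneg Δ _ (Equiv.prodCongr e₁ e₂)
      (rook_adj_prodCongr hadj e₁ e₂) (dirWeight_map_prodCongr hJ e₁ e₂) hχK hχH) σ
  have hreal : ∀ σ, χ σ = (((χ σ).re : ℝ) : ℂ) := fun σ =>
    Complex.ext (by rw [Complex.ofReal_re]) (by rw [Complex.ofReal_im]; exact (hχnn σ).2)
  set a : ℝ := (χ (Pi.single (a₀, b₀) 1 + Pi.single (a₁, b₀) 1)).re with hadef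
  set b : ℝ := (χ (Pi.single (a₀, b₀) 1 + Pi.single (a₀, b₁) 1)).re with hbdef
  set cc : ℝ := (χ (Pi.single (a₀, b₀) 1 + Pi.single (a₁, b₁) 1)).re with hccdef
  have hA : ∀ x y : α × β, x.1 ≠ y.1 → x.2 = y.2 →
      χ (Pi.single x 1 + Pi.single y 1) = (a : ℂ) := by
    intro x y h1 h2
    rw [wrowPair_eq hfixχ h1 h2 (i' := (a₀, b₀)) (j' := (a₁, b₀)) hα rfl]
    exact hreal _
  have hB : ∀ x y : α × β, x.1 = y.1 → x.2 ≠ y.2 →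
      χ (Pi.single x 1 + Pi.single y 1) = (b : ℂ) := by
    intro x y h1 h2
    rw [wcolPair_eq hfixχ h1 h2 (i' := (a₀, b₀)) (j' := (a₀, b₁)) rfl hβ]
    exact hreal _
  have hC : ∀ x y : α × β, x.1 ≠ y.1 → x.2 ≠ y.2 →
      χ (Pi.single x 1 + Pi.single y 1) = (cc : ℂ) := by
    intro x y h1 h2
    rw [wfarPair_eq hfixχ h1 h2 (i' := (a₀, b₀)) (j' := (a₁, b₁)) hα hβ]
    exact hreal _
  have ha0 : 0 ≤ a := (hχnn _).1
  have hb0 : 0 ≤ b := (hχnn _).1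
  have hc0 : 0 ≤ cc := (hχnn _).1
  -- the three class equations, in the normalised form of `…RookWeightedClasses`
  obtain ⟨h1, h2, h3⟩ := wrook_eigen_relations hadj J hw₁ hw₂ hα hβ hA hB hC hχH _ rfl
  set K : ℝ := (1 : ℝ) / 4 * (∑ e ∈ G.edgeFinset, J e)
      - (((Fintype.card α : ℝ) - 1) * (-J₁) + ((Fintype.card β : ℝ) - 1) * (-J₂)) with hK
  set E : ℝ := lowestEnergyInSector 1 (xxzHamiltonianWith 1 G J Δ) ((Fintype.card (α × β) : ℝ) / 2 - 2)
    with hE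
  have hrowE : E * a = Δ * (K - J₁) * a - (J₁ * (p - 1) * a + J₂ * q * cc) := by
    rw [hp, hq]; linear_combination h1
  have hcolE : E * b = Δ * (K - J₂) * b - (J₂ * (q - 1) * b + J₁ * p * cc) := by
    rw [hp, hq]; linear_combination h2
  have hfarE : E * cc = Δ * K * cc - (J₂ * a + J₁ * b + (J₁ * (p - 1) + J₂ * (q - 1)) * cc) := by
    rw [hp, hq]; linear_combination h3
  -- `cc > 0`: otherwise `χ = 0`
  have hsuppχ := apply_eq_zero_of_mem_twoMagnonSector hχK
  have hcpos : 0 < cc := by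
    rcases hc0.lt_or_eq with h | h
    · exact h
    exfalso
    apply hχ0
    obtain ⟨ha', hb'⟩ := wrook_far_ne_zero hJ₁ hJ₂ ha0 hb0 h.symm hfarE
    funext σ
    by_cases hσ : (∑ z, (σ z : ℕ)) = 2
    · obtain ⟨i, j, hij, rfl⟩ := eq_pair_of_weight_eq_two hσ
      by_cases hi1 : i.1 = j.1
      · have hi2 : i.2 ≠ j.2 := fun h2 => hij (Prod.ext hi1 h2)
        rw [hB i j hi1 hi2, hb', Complex.ofReal_zero, Pi.zero_apply]
      · by_cases hi2 : i.2 = j.2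
        · rw [hA i j hi1 hi2, ha', Complex.ofReal_zero, Pi.zero_apply]
        · rw [hC i j hi1 hi2, ← h, Complex.ofReal_zero, Pi.zero_apply]
    · rw [hsuppχ σ hσ, Pi.zero_apply]
  obtain ⟨hu, hv⟩ := wrook_classes_pos hJ₁ hJ₂ hp0 hq0 ha0 hb0 hcpos hrowE hcolE hfarE
  obtain ⟨e1, e2⟩ := wrook_point_of_classes hJ₁ hcpos.ne' hrowE hcolE hfarE
  refine ⟨a / cc, b / cc, (1 - b / cc) + (J₂ / J₁) * (1 - a / cc), hu, hv, e1, e2, rfl, ?_⟩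
  -- the flat overlap
  obtain ⟨hflat, hnorm⟩ := rook_flat_norm hφ hχK hA hB hC p q hp hq
  set m₁ : ℝ := p * a + q * b + p * q * cc with hm₁
  set m₂ : ℝ := p * a ^ 2 + q * b ^ 2 + p * q * cc ^ 2 with hm₂
  have hm₂pos : 0 < m₂ := by
    have : 0 < p * q * cc ^ 2 := by positivity
    have h1' : 0 ≤ p * a ^ 2 := by positivity
    have h2' : 0 ≤ q * b ^ 2 := by positivity
    rw [hm₂]; linarith
  have hcn : ‖c‖ ^ 2 * (star χ ⬝ᵥ χ).re = 1 := by
    have h := gn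
    rw [hc, star_smul, smul_dotProduct, dotProduct_smul, star_dotProduct_self_eq_re χ, smul_eq_mul,
      smul_eq_mul, Complex.star_def, ← mul_assoc, Complex.conj_mul', ← Complex.ofReal_pow,
      ← Complex.ofReal_mul] at h
    exact_mod_cast h
  have hov : ‖star φ ⬝ᵥ ψ‖ ^ 2 = ‖c‖ ^ 2 * ((Fintype.card (α × β) : ℝ) / 2 * m₁) ^ 2 := by
    rw [hc, dotProduct_smul, smul_eq_mul, norm_mul, mul_pow, hflat, Complex.norm_real,
      Real.norm_eq_abs, sq_abs]
  have hc2 : ‖c‖ ^ 2 = 1 / ((Fintype.card (α × β) : ℝ) / 2 * m₂) := by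
    rw [hnorm] at hcn
    rw [eq_div_iff (by positivity)]
    linarith
  have hX : m₁ ^ 2 / m₂ = (p * (a / cc) + q * (b / cc) + p * q) ^ 2 /
      (p * (a / cc) ^ 2 + q * (b / cc) ^ 2 + p * q) := by
    have hden : 0 < p * (a / cc) ^ 2 + q * (b / cc) ^ 2 + p * q := by positivity
    rw [div_eq_div_iff hm₂pos.ne' hden.ne', hm₁, hm₂]
    field_simp
  rw [hov, hc2, ← hX]
  have hN2 : (Fintype.card (α × β) : ℝ) / 2 ≠ 0 := by
    have : (0 : ℝ) < Fintype.card (α × β) := by exact_mod_cast Fintype.card_pos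
    positivity
  field_simp

/-! ### THEOREM R -/

/-- **THEOREM R (weighted rook graphs; theory seat hubbard-h0-rotor-theory-1, ROTOR-THEORY-5 §41).**
On the rook graph `K_{|α|} □ K_{|β|}` (`|α|, |β| ≥ 2`) with direction couplings `−J₁` (row bonds)
and `−J₂` (column bonds), `J₁, J₂ > 0` ARBITRARY, in the two-magnon sector `S^z_tot = |V|/2 − 2`,
for `Δ₁ ≤ Δ₂ < 1` and normalised sector ground states the condensate is non-decreasing:
`Λ(ψ₁) ≤ Λ(ψ₂)`.  Two contact orbits, any anisotropy of the couplings (including the discordant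
regime), no lower bound on `Δ₁`.  Tasaki (2020) §2.4, App. A. [folklore] -/
theorem wrook_twoMagnon_condensate_monotone (G : SimpleGraph (α × β)) [DecidableRel G.Adj]
    (hadj : ∀ x y : α × β, G.Adj x y ↔ (x.1 ≠ y.1 ∧ x.2 = y.2) ∨ (x.1 = y.1 ∧ x.2 ≠ y.2))
    (hα : 1 < Fintype.card α) (hβ : 1 < Fintype.card β)
    (J : Sym2 (α × β) → ℝ) {J₁ J₂ : ℝ} (hJ₁ : 0 < J₁) (hJ₂ : 0 < J₂)
    (hJ : ∀ x y : α × β, J s(x, y) = if x.2 = y.2 then -J₁ else -J₂)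
    {Δ₁ Δ₂ : ℝ} (h12 : Δ₁ ≤ Δ₂) (h2 : Δ₂ < 1) {ψ₁ ψ₂ : (α × β → Fin 2) → ℂ}
    (g₁m : ψ₁ ∈ spinZSector (Λ := α × β) 1 ((Fintype.card (α × β) : ℝ) / 2 - 2))
    (g₁n : star ψ₁ ⬝ᵥ ψ₁ = 1)
    (g₁e : xxzHamiltonianWith 1 G J Δ₁ *ᵥ ψ₁ =
      ((lowestEnergyInSector 1 (xxzHamiltonianWith 1 G J Δ₁) ((Fintype.card (α × β) : ℝ) / 2 - 2) : ℝ) : ℂ) • ψ₁)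
    (g₂m : ψ₂ ∈ spinZSector (Λ := α × β) 1 ((Fintype.card (α × β) : ℝ) / 2 - 2))
    (g₂n : star ψ₂ ⬝ᵥ ψ₂ = 1)
    (g₂e : xxzHamiltonianWith 1 G J Δ₂ *ᵥ ψ₂ =
      ((lowestEnergyInSector 1 (xxzHamiltonianWith 1 G J Δ₂) ((Fintype.card (α × β) : ℝ) / 2 - 2) : ℝ) : ℂ) • ψ₂) :
    (star ψ₁ ⬝ᵥ (((∑ x, onSite x (spinRaise 1)) * (∑ y, onSite y (spinLower 1)) : Op (α × β) 2) *ᵥ ψ₁)).re ≤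
      (star ψ₂ ⬝ᵥ (((∑ x, onSite x (spinRaise 1)) * (∑ y, onSite y (spinLower 1)) : Op (α × β) 2) *ᵥ ψ₂)).re := by
  obtain ⟨a₀, a₁, hα'⟩ := Fintype.one_lt_card_iff.mp hα
  obtain ⟨b₀, b₁, hβ'⟩ := Fintype.one_lt_card_iff.mp hβ
  haveI : Nonempty α := ⟨a₀⟩
  haveI : Nonempty β := ⟨b₀⟩
  have hG : G.Connected := rook_connected hadj
  have hJneg : ∀ e ∈ G.edgeFinset, J e < 0 := fun e _ => dirWeight_neg hJ₁ hJ₂ hJ e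
  set φ : (α × β → Fin 2) → ℂ := fun σ => if (∑ z, (σ z : ℕ)) = 2 then 1 else 0 with hφdef
  have hφ : ∀ σ, φ σ = if (∑ z, (σ z : ℕ)) = 2 then 1 else 0 := fun σ => rfl
  -- the ground states are fixed by the coordinate permutations, which act transitively
  have htrans : ∀ {Δ : ℝ} {ψ : (α × β → Fin 2) → ℂ},
      ψ ∈ spinZSector (Λ := α × β) 1 ((Fintype.card (α × β) : ℝ) / 2 - 2) →
      xxzHamiltonianWith 1 G J Δ *ᵥ ψ =
        ((lowestEnergyInSector 1 (xxzHamiltonianWith 1 G J Δ)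
          ((Fintype.card (α × β) : ℝ) / 2 - 2) : ℝ) : ℂ) • ψ →
      ∀ k k' : α × β, ∃ π : α × β ≃ α × β, π k = k' ∧ ∀ σ : α × β → Fin 2, ψ (σ ∘ π) = ψ σ := by
    intro Δ ψ hm he k k'
    refine ⟨Equiv.prodCongr (Equiv.swap k.1 k'.1) (Equiv.swap k.2 k'.2), ?_, fun σ => ?_⟩
    · rw [prodCongr_apply_mk, Equiv.swap_apply_left, Equiv.swap_apply_left]
    · exact congrFun (xxzWith_sectorGS_comp_eq_self G hG J hJneg Δ _ _
        (rook_adj_prodCongr hadj _ _) (dirWeight_map_prodCongr hJ _ _) hm he) σ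
  rw [condensate_eq_flatOverlap_of_transitive_invariance (a₀, b₀) hφ g₁m (htrans g₁m g₁e),
    condensate_eq_flatOverlap_of_transitive_invariance (a₀, b₀) hφ g₂m (htrans g₂m g₂e), g₁n, g₂n]
  have hn : (0 : ℝ) < Fintype.card (α × β) := by
    have : 0 < Fintype.card (α × β) := Fintype.card_pos_iff.2 ⟨(a₀, b₀)⟩
    exact_mod_cast this
  suffices hkey : ‖star φ ⬝ᵥ ψ₁‖ ^ 2 ≤ ‖star φ ⬝ᵥ ψ₂‖ ^ 2 by
    have h4 : 0 ≤ 4 / (Fintype.card (α × β) : ℝ) := by positivity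
    nlinarith [mul_le_mul_of_nonneg_left hkey h4]
  set p : ℝ := (Fintype.card α : ℝ) - 1 with hp
  set q : ℝ := (Fintype.card β : ℝ) - 1 with hq
  have hp1 : 1 ≤ p := by
    have : (2 : ℝ) ≤ Fintype.card α := by exact_mod_cast hα
    rw [hp]; linarith
  have hq1 : 1 ≤ q := by
    have : (2 : ℝ) ≤ Fintype.card β := by exact_mod_cast hβ
    rw [hq]; linarith
  obtain ⟨u₁, v₁, E₁, hu₁, hv₁, a1, a2, a3, hov₁⟩ :=
    wrook_flatOverlap_eq G hadj hα' hβ' J hJ₁ hJ₂ hJ hφ g₁m g₁n g₁e p q hp hq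
  obtain ⟨u₂, v₂, E₂, hu₂, hv₂, b1, b2, b3, hov₂⟩ :=
    wrook_flatOverlap_eq G hadj hα' hβ' J hJ₁ hJ₂ hJ hφ g₂m g₂n g₂e p q hp hq
  rw [hov₁, hov₂]
  -- THEOREM R, analytic form: the point at the smaller coupling `1 − Δ₂` has the larger overlap
  have hW := wrook_flatOverlap_antitone_all p q (J₂ / J₁) hp1 hq1 (div_pos hJ₂ hJ₁)
    (σ₁ := 1 - Δ₂) (σ₂ := 1 - Δ₁) (by linarith) (by linarith) hu₂ hv₂ hu₁ hv₁ b1 b2 b3 a1 a2 a3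
  have hnn : 0 < p + q + p * q := by positivity
  have e : ∀ A B : ℝ, 0 < B → (p + q + p * q) * (A / ((p + q + p * q) * B)) = A / B := by
    intro A B hB
    field_simp
  have hW' := mul_le_mul_of_nonneg_left hW hnn.le
  rw [e _ _ (by positivity), e _ _ (by positivity)] at hW'
  exact mul_le_mul_of_nonneg_left hW' (by positivity)

end Summit.HubbardSuperconductivity.HubbardSuperconductivity.Theorems.AnisotropyChord.TwoMagnon
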